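import Mathlib
import HarnessLib
import Literature.NumberTheory.LFunctions.VanDerCorputZeta

/-!
# Vinogradov's mean value theorem, II: trigonometric polynomials on the torus `[0,1]^n`

Topic `Literature/NumberTheory/LFunctions`. Everything in this file is PROVED (no named facts).

**Position in the tree.** This is part II of a decomposition of Vinogradov's mean value theorem
in the arithmetic form of Ivić, *The Riemann Zeta-Function* (1985), §6.2, Lemmas 6.1–6.3; part I is
`VinogradovMeanValueCount.lean` (the counting function `Literature.NumberTheory.LFunctions.VMV.J`,
Ivić (6.9)–(6.16)), parts III–V (`VinogradovMeanValueStepA/StepB`, `VinogradovLinnik`) prove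
Ivić's Lemmas 6.1–6.2 with the tools of this file. The end consumer is the Vinogradov–Korobov
zero-free region for Dirichlet `L`-functions (Ivić Theorem 6.1 / 6.2 run for `∑ (n+w)^{it}`), which
at present enters `Literature/NumberTheory/Sieve/MoebiusShiftedPrimesPrimeCharacterSum.lean`
(Lichtman 2020, Theorem 1.1) only through the named fact
`Literature.NumberTheory.LFunctions.Khale2024_zeroFreeRegion`; the decomposition is meant to
replace that input by a theorem.

**Content.** The analytic half of Ivić's §6.2: the characters `e(α·λ) = exp(2πi ∑_j α_j λ_j)` of the
torus, their orthogonality on the unit box (Ivić (6.8)), finite trigonometric polynomials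
`∑_{i ∈ s} e(α · v_i)` with integer frequency vectors `v_i ∈ ℤ^n`, and the counting identity

  `∫_{[0,1]^n} (∑_{i∈s} e(α·v_i)) · conj(∑_{i'∈s'} e(α·w_{i'})) dα = #{(i,i') : v_i = w_{i'}}`

(hence `∫ |∑_i e(α·v_i)|² = #{(i,i') : v_i = v_{i'}}`), which turns mean values into numbers of
solutions of Diophantine systems (Ivić (6.5) versus (6.9), and the integrals in the proof of
Lemma 6.2).

**Mathlib / tree search.** The one-variable character is the same-directory
`Literature.NumberTheory.LFunctions.VdC.e` (`e(x) = exp(2πix)`, `VanDerCorputZeta.lean`), whose API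
(`norm_e`, `e_add`, `e_neg`, `e_int`) we reuse; `E v α` is the product `∏_j e(v_j α_j)`
(= `e(∑_j v_j α_j)`, `E_eq_e_sum`), the product form being the one that meets
`MeasureTheory.integral_fintype_prod_eq_prod` (Fubini on `Fin n → ℝ` with
`MeasureTheory.Measure.restrict_pi_pi`). The box `box n = Set.univ.pi (fun _ ↦ Icc 0 1)` is
`Set.Icc (0 : Fin n → ℝ) 1` (`Set.pi_univ_Icc`); we keep the `pi` form for the same reason.

## References

* A. Ivić, *The Riemann Zeta-Function*, Wiley 1985, §6.2, (6.5), (6.8), (6.14).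
-/

noncomputable section

open Finset MeasureTheory Complex
open scoped Real ComplexConjugate

namespace Literature.NumberTheory.LFunctions
namespace VMV

variable {n : ℕ}

/-! ### Characters of the torus -/

/-- `E v α = e(α · v) = ∏_j e(v_j α_j)` for an integer vector `v ∈ ℤ^n` and `α ∈ ℝ^n`, with the
tree's `e(x) = exp(2πix)` (`VdC.e`). [cite: Ivic1985, (6.8)] -/
def E (v : Fin n → ℤ) (α : Fin n → ℝ) : ℂ := ∏ j, VdC.e ((v j : ℝ) * α j)

/-- `E v α = e(∑_j v_j α_j)`: the product form agrees with the character of the inner product.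
[folklore] -/
theorem E_eq_e_sum (v : Fin n → ℤ) (α : Fin n → ℝ) : E v α = VdC.e (∑ j, (v j : ℝ) * α j) := by
  classical
  unfold E
  induction (univ : Finset (Fin n)) using Finset.induction_on with
  | empty => simp [VdC.e_zero]
  | insert a s ha ih => rw [prod_insert ha, sum_insert ha, VdC.e_add, ih]

/-- `|e(α·v)| = 1`. [folklore] -/
theorem norm_E (v : Fin n → ℤ) (α : Fin n → ℝ) : ‖E v α‖ = 1 := by
  rw [E, norm_prod]
  simp [VdC.norm_e]

/-- `e(α·(v+w)) = e(α·v) e(α·w)`. [folklore] -/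
theorem E_add (v w : Fin n → ℤ) (α : Fin n → ℝ) : E (v + w) α = E v α * E w α := by
  simp only [E, ← prod_mul_distrib, Pi.add_apply, Int.cast_add, add_mul, VdC.e_add]

/-- `e(α·0) = 1`. [folklore] -/
theorem E_zero (α : Fin n → ℝ) : E (0 : Fin n → ℤ) α = 1 := by
  simp [E, VdC.e_zero]

/-- `e(α·(−v)) = conj e(α·v)`. [folklore] -/
theorem E_neg (v : Fin n → ℤ) (α : Fin n → ℝ) : E (-v) α = conj (E v α) := by
  simp only [E, map_prod, Pi.neg_apply, Int.cast_neg, neg_mul, VdC.e_neg]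

/-- `e(α·(v−w)) = e(α·v) conj e(α·w)`. [folklore] -/
theorem E_sub (v w : Fin n → ℤ) (α : Fin n → ℝ) : E (v - w) α = E v α * conj (E w α) := by
  rw [sub_eq_add_neg, E_add, E_neg]

/-- `e(α·∑_i v_i) = ∏_i e(α·v_i)`. [folklore] -/
theorem E_sum {ι : Type*} (s : Finset ι) (v : ι → Fin n → ℤ) (α : Fin n → ℝ) :
    E (∑ i ∈ s, v i) α = ∏ i ∈ s, E (v i) α := by
  classical
  induction s using Finset.induction_on with
  | empty => simp [E_zero]
  | insert a s ha ih => rw [sum_insert ha, prod_insert ha, E_add, ih]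

/-- `x ↦ e(mx)` is continuous. [folklore] -/
theorem continuous_e_mul (m : ℝ) : Continuous fun x : ℝ => VdC.e (m * x) := by
  unfold VdC.e; fun_prop

/-- `α ↦ e(α·v)` is continuous. [folklore] -/
theorem continuous_E (v : Fin n → ℤ) : Continuous (E v) := by
  unfold E
  exact continuous_finsetProd _ fun j _ => (continuous_e_mul (v j : ℝ)).comp (continuous_apply j)

/-! ### The unit box and orthogonality -/

/-- The unit box `[0,1]^n`. [folklore] -/
def box (n : ℕ) : Set (Fin n → ℝ) := Set.univ.pi fun _ : Fin n => Set.Icc (0 : ℝ) 1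

/-- `[0,1]^n` is compact. [folklore] -/
theorem isCompact_box (n : ℕ) : IsCompact (box n) := isCompact_univ_pi fun _ => isCompact_Icc

/-- `[0,1]^n` is measurable. [folklore] -/
theorem measurableSet_box (n : ℕ) : MeasurableSet (box n) :=
  MeasurableSet.univ_pi fun _ => measurableSet_Icc

/-- `∫_0^1 e(m x) dx = [m = 0]` for integers `m`. [folklore] -/
theorem integral_e_mul (m : ℤ) :
    ∫ x in Set.Icc (0 : ℝ) 1, VdC.e ((m : ℝ) * x) = if m = 0 then 1 else 0 := by
  rw [integral_Icc_eq_integral_Ioc, ← intervalIntegral.integral_of_le zero_le_one]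
  split_ifs with hm
  · simp [VdC.e_zero, hm]
  · have hc : (2 * π * I * (m : ℂ)) ≠ 0 := by
      apply mul_ne_zero (mul_ne_zero (mul_ne_zero two_ne_zero (by exact_mod_cast Real.pi_ne_zero))
        Complex.I_ne_zero)
      exact_mod_cast hm
    have h := integral_exp_mul_complex (a := 0) (b := 1) hc
    have he : ∀ x : ℝ, VdC.e ((m : ℝ) * x) = Complex.exp (2 * π * I * (m : ℂ) * (x : ℂ)) := by
      intro x; unfold VdC.e; congr 1; push_cast; ring
    simp_rw [he]
    rw [h]
    rw [Complex.ofReal_one, mul_one, Complex.ofReal_zero, mul_zero, Complex.exp_zero,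
      show 2 * (π : ℂ) * I * (m : ℂ) = (m : ℂ) * (2 * π * I) by ring, Complex.exp_int_mul_two_pi_mul_I]
    simp

/-- **Orthogonality (Ivić (6.8))**: `∫_{[0,1]^n} e(α·v) dα = [v = 0]`. [cite: Ivic1985, (6.8)] -/
theorem integral_E (v : Fin n → ℤ) : ∫ α in box n, E v α = if v = 0 then 1 else 0 := by
  have hvol : (volume : Measure (Fin n → ℝ)).restrict (box n) =
      Measure.pi fun _ : Fin n => (volume : Measure ℝ).restrict (Set.Icc 0 1) := by
    rw [box, MeasureTheory.volume_pi, Measure.restrict_pi_pi]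
  rw [hvol]
  unfold E
  rw [MeasureTheory.integral_fintype_prod_eq_prod (f := fun j x => VdC.e ((v j : ℝ) * x))]
  simp_rw [integral_e_mul]
  split_ifs with hv
  · simp [hv]
  · obtain ⟨j, hj⟩ : ∃ j, v j ≠ 0 := by
      by_contra h; push Not at h; exact hv (funext h)
    exact prod_eq_zero (mem_univ j) (if_neg hj)

/-! ### Trigonometric polynomials and the counting identity -/

/-- The trigonometric polynomial `∑_{i ∈ s} e(α · v_i)` with frequencies `v_i ∈ ℤ^n`.
[cite: Ivic1985, (6.14)] -/
def tp {ι : Type*} (s : Finset ι) (v : ι → Fin n → ℤ) (α : Fin n → ℝ) : ℂ := ∑ i ∈ s, E (v i) α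

/-- Trigonometric polynomials are continuous. [folklore] -/
theorem continuous_tp {ι : Type*} (s : Finset ι) (v : ι → Fin n → ℤ) : Continuous (tp s v) := by
  unfold tp; exact continuous_finsetSum _ fun i _ => continuous_E _

/-- `|∑_{i∈s} e(α·v_i)| ≤ #s`. [folklore] -/
theorem norm_tp_le {ι : Type*} (s : Finset ι) (v : ι → Fin n → ℤ) (α : Fin n → ℝ) :
    ‖tp s v α‖ ≤ s.card := by
  unfold tp
  refine (norm_sum_le _ _).trans ?_
  simp [norm_E]

/-- Product of two trigonometric polynomials = the polynomial of the summed frequencies over the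
product index set. [folklore] -/
theorem tp_mul {ι κ : Type*} (s : Finset ι) (s' : Finset κ) (v : ι → Fin n → ℤ)
    (w : κ → Fin n → ℤ) (α : Fin n → ℝ) :
    tp s v α * tp s' w α = tp (s ×ˢ s') (fun ii' => v ii'.1 + w ii'.2) α := by
  unfold tp
  rw [sum_mul_sum, sum_product]
  refine sum_congr rfl fun i _ => sum_congr rfl fun i' _ => ?_
  rw [E_add]

/-- `conj ∑_i e(α·v_i) = ∑_i e(α·(−v_i))`. [folklore] -/
theorem conj_tp {ι : Type*} (s : Finset ι) (v : ι → Fin n → ℤ) (α : Fin n → ℝ) :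
    conj (tp s v α) = tp s (fun i => -v i) α := by
  unfold tp
  rw [map_sum]
  exact sum_congr rfl fun i _ => (E_neg _ _).symm

/-- A product of trigonometric polynomials over the coordinates of `y ∈ ∏_l t_l` is the
trigonometric polynomial of the summed frequencies. [folklore] -/
theorem prod_tp_eq {m : ℕ} {κ : Type*} [DecidableEq κ] (t : Fin m → Finset κ)
    (v : Fin m → κ → Fin n → ℤ) (α : Fin n → ℝ) :
    ∏ l, tp (t l) (v l) α = tp (Fintype.piFinset t) (fun y => ∑ l, v l (y l)) α := by
  unfold tp
  rw [prod_univ_sum]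
  refine sum_congr rfl fun y _ => ?_
  rw [E_sum]

/-- Continuous complex functions are integrable on the compact box `[0,1]^n`. [folklore] -/
theorem integrableOn_box_of_continuous {f : (Fin n → ℝ) → ℂ} (hf : Continuous f) :
    IntegrableOn f (box n) :=
  hf.continuousOn.integrableOn_compact (isCompact_box n)

/-- Continuous real functions are integrable on the compact box `[0,1]^n`. [folklore] -/
theorem integrableOn_box_of_continuous_real {f : (Fin n → ℝ) → ℝ} (hf : Continuous f) :
    IntegrableOn f (box n) :=
  hf.continuousOn.integrableOn_compact (isCompact_box n)

/-- **The counting identity.** For finite families of integer frequency vectors `v_i` (`i ∈ s`)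
and `w_{i'}` (`i' ∈ s'`):
`∫_{[0,1]^n} (∑_i e(α·v_i)) conj(∑_{i'} e(α·w_{i'})) dα = #{(i,i') ∈ s × s' : v_i = w_{i'}}`.
[cite: Ivic1985, §6.2, (6.8)–(6.9)] -/
theorem integral_tp_mul_conj_tp {ι κ : Type*} (s : Finset ι) (s' : Finset κ) (v : ι → Fin n → ℤ)
    (w : κ → Fin n → ℤ) :
    ∫ α in box n, tp s v α * conj (tp s' w α) =
      (((s ×ˢ s').filter fun ii' => v ii'.1 = w ii'.2).card : ℂ) := by
  classical
  simp_rw [conj_tp, tp_mul]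
  unfold tp
  rw [integral_finsetSum _ fun ii' _ => integrableOn_box_of_continuous (continuous_E _)]
  simp_rw [integral_E]
  rw [card_filter, Nat.cast_sum]
  refine sum_congr rfl fun ii' _ => ?_
  simp only [add_neg_eq_zero, Nat.cast_ite, Nat.cast_one, Nat.cast_zero]

/-- **Mean square = number of solutions**:
`∫_{[0,1]^n} |∑_{i∈s} e(α·v_i)|² dα = #{(i,i') ∈ s × s : v_i = v_{i'}}`.
[cite: Ivic1985, §6.2, (6.5) and (6.9)] -/
theorem integral_norm_sq_tp {ι : Type*} (s : Finset ι) (v : ι → Fin n → ℤ) :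
    ∫ α in box n, ‖tp s v α‖ ^ 2 = (((s ×ˢ s).filter fun ii' => v ii'.1 = v ii'.2).card : ℝ) := by
  have h := integral_tp_mul_conj_tp s s v v
  simp_rw [Complex.mul_conj'] at h
  have h2 : ∫ α in box n, ((‖tp s v α‖ ^ 2 : ℝ) : ℂ) =
      (((s ×ˢ s).filter fun ii' => v ii'.1 = v ii'.2).card : ℂ) := by
    simpa only [Complex.ofReal_pow] using h
  rw [integral_complex_ofReal] at h2
  exact_mod_cast h2

end VMV
end Literature.NumberTheory.LFunctions
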